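import Summits.Ventures.CertifiedManyBodySolver.Downfold.EmeryThermalSeam
import Literature.MathematicalPhysics.QuantumLattice.EmeryThreeBandThermalDensities
import HarnessLib

/-!
# Thermal OBSERVABLE windows on a typed Emery box: the electron count per CuO₂ and the energy per cell of EVERY `2×2`-periodic equilibrium
# at every box point, from three box words on the cell pressure (the `T > 0` seam's reading of the S1 hole-count row)

Venture CertifiedManyBodySolver, cell `pub/hubbard-downfold` (S1 = ROUTER) × crew hubbard-fast S2 «multi-band × T > 0» (D-0096 (ii)); seat hubbard-downfold-mod-4.
Namespace `Summit.Ventures.CertifiedManyBodySolver.Downfold`. Sequel of `EmeryThermalSeam` (p635228: cap / floor doors for `emeryCellPressure β (emeryLine s q)` on a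
typed box, `−εp` = chemical potential). hubbard-box-p1's Griffiths brackets (`EmeryThreeBandThermalPressure` §5, `EmeryThreeBandThermalDensities` §2) turn three
certified pressures at ONE `θ` into a window for the energy per cell (β-chords) and for the electron count `n(ω) = ρ_Cu + ρ_{O_x} + ρ_{O_y}` per CuO₂ (level-direction
chords) of every equilibrium at `(β, θ)`. On a typed box the level direction IS the reference-level knob: `emeryLine s (emeryLineCoords (εp + c) p) =
emeryLine s (emeryLineCoords εp p) + c • levelDir` (`EmeryReferenceLevel`), and `levelDir = emeryLevelDir` (`levelDir_eq_emeryLevelDir`). Hence, in cell-pressure units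
(`P_cell = 4P − 2 log 2`, so the `2 log 2` cancels in every chord):

* **`holdsOn_emery_electronCount_window`**: a floor word `L ≤ P_cell` at reference level `εp` and cap words `P_cell ≤ U₊` at `εp + δ`, `P_cell ≤ U₋` at `εp − δ`
  (each a `HoldsOn` on the SAME box, e.g. from `holdsOn_emeryCellPressureFloor_of_rayleighTraces` / `holdsOn_emeryCellPressureCap_of_cornerCaps`) give, at EVERY box
  point and for EVERY equilibrium `ω` at `(β, θ(p))`: `(L − U₊)/(βδ) ≤ n(ω) ≤ (U₋ − L)/(βδ)` — the `T > 0` electron count per CuO₂ that S1's `n_holes` row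
  (`n = 6 − n_holes − 1`… in the decorated convention `n = 4ρ`) is to be compared with;
* **`holdsOn_emery_cellEnergy_window`**: floor at `β`, caps at `β ± δ` (same `εp`) ⇒ `(L − U₊)/(4δ) ≤ ē(ω) ≤ (U₋ − L)/(4δ)` per site of the decorated lattice;
* the point forms `emery_electronCount_mem_Icc_of_cellPressureBounds` / `emery_cellMeanEnergy_mem_Icc_of_cellPressureBounds` (cell-pressure restatements of box-p1's
  theorems) and the La₂CuO₄ instances on `emeryBoxLa214v123`.

Everything PROVED (0 sorry); no definition. HONEST SCOPE: doors; no certificate, no number; a window is as wide as `(U₋ + U₊ − 2L)/(βδ)` — informative only once the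
cap side (an upper bound on a boosted 12-site cluster partition function) exists; no phase word.
-/

noncomputable section

namespace Summit.Ventures.CertifiedManyBodySolver.Downfold

open NonemptyInterval Matrix Finset Literature.Probability.LatticeModels
open Literature.MathematicalPhysics.QuantumLattice Literature.Computation.Certificates ClusterLowerBound
open scoped BigOperators ComplexOrder

/-! ## §1 Point forms in cell-pressure units -/

/-- The seam's level direction IS box-p1's: `levelDir = emeryLevelDir` (indicator of the three level atoms `8, 9, 10`). [folklore] -/
theorem levelDir_eq_emeryLevelDir : levelDir = emeryLevelDir := by
  funext a
  fin_cases a <;> simp [levelDir, emeryLevelDir]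

/-- `emeryPressure = (emeryCellPressure + 2 log 2)/4`. [cite: Israel1979, Thm. I.2.4] -/
theorem emeryPressure_eq_cell (β : ℝ) (θ : Fin 14 → ℝ) : emeryPressure β θ = (emeryCellPressure β θ + 2 * Real.log 2) / 4 := by
  rw [emeryCellPressure]; ring

/-- **Electron count per CuO₂ from three cell pressures** (`β, δ > 0`): a floor `L ≤ P_cell(β, θ)` and caps `P_cell(β, θ + δ·levelDir) ≤ U₊`,
`P_cell(β, θ − δ·levelDir) ≤ U₋` give `(L − U₊)/(βδ) ≤ n(ω) ≤ (U₋ − L)/(βδ)` for every equilibrium `ω` at `(β, θ)`, `n = ρ_Cu + ρ_{O_x} + ρ_{O_y}`.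
[cite: Griffiths1964, Eq. (39) and Fig. 3] [cite: Israel1979, Thm. I.2.4] -/
theorem emery_electronCount_mem_Icc_of_cellPressureBounds {β : ℝ} (hβ : 0 < β) {θ : Fin 14 → ℝ} {ω : InfVolFermionState 2}
    (h : ω.IsPerVarEquilibrium β liebPeriods (emeryInteraction θ) 1) {δ : ℝ} (hδ : 0 < δ) {L Uplus Uminus : ℝ}
    (hL : L ≤ emeryCellPressure β θ) (hUp : emeryCellPressure β (θ + δ • levelDir) ≤ Uplus)
    (hUm : emeryCellPressure β (θ + (-δ) • levelDir) ≤ Uminus) :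
    ω.densityAt cuSite + ω.densityAt oxSite + ω.densityAt oySite ∈ Set.Icc ((L - Uplus) / (β * δ)) ((Uminus - L) / (β * δ)) := by
  rw [levelDir_eq_emeryLevelDir] at hUp hUm
  have hw := emery_electronCount_mem_Icc_of_bounds hβ h hδ (L := (L + 2 * Real.log 2) / 4) (Uplus := (Uplus + 2 * Real.log 2) / 4)
    (Uminus := (Uminus + 2 * Real.log 2) / 4) (by rw [emeryPressure_eq_cell]; linarith) (by rw [emeryPressure_eq_cell]; linarith)
    (by rw [emeryPressure_eq_cell]; linarith)
  have e1 : 4 * ((L + 2 * Real.log 2) / 4 - (Uplus + 2 * Real.log 2) / 4) = L - Uplus := by ring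
  have e2 : 4 * ((Uminus + 2 * Real.log 2) / 4 - (L + 2 * Real.log 2) / 4) = Uminus - L := by ring
  rw [e1, e2] at hw
  exact hw

/-- **Energy per site from three cell pressures** (`δ > 0`): `L ≤ P_cell(β)`, `P_cell(β+δ) ≤ U₊`, `P_cell(β−δ) ≤ U₋` at one `θ` give
`(L − U₊)/(4δ) ≤ ē(ω) ≤ (U₋ − L)/(4δ)` for every equilibrium at `(β, θ)` (`ē` per site of the decorated lattice = cell energy / 4). [cite: Griffiths1964, Eq. (39) and Fig. 3] -/
theorem emery_cellMeanEnergy_mem_Icc_of_cellPressureBounds {β : ℝ} {θ : Fin 14 → ℝ} {ω : InfVolFermionState 2}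
    (h : ω.IsPerVarEquilibrium β liebPeriods (emeryInteraction θ) 1) {δ : ℝ} (hδ : 0 < δ) {L Uplus Uminus : ℝ}
    (hL : L ≤ emeryCellPressure β θ) (hUp : emeryCellPressure (β + δ) θ ≤ Uplus) (hUm : emeryCellPressure (β - δ) θ ≤ Uminus) :
    InfVolFermionState.cellMeanEnergy liebPeriods (emeryInteraction θ) ω 1 ∈ Set.Icc ((L - Uplus) / (4 * δ)) ((Uminus - L) / (4 * δ)) := by
  have hw := emery_cellMeanEnergy_mem_Icc_of_bounds h hδ (L := (L + 2 * Real.log 2) / 4) (Uplus := (Uplus + 2 * Real.log 2) / 4)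
    (Uminus := (Uminus + 2 * Real.log 2) / 4) (by rw [emeryPressure_eq_cell]; linarith) (by rw [emeryPressure_eq_cell]; linarith)
    (by rw [emeryPressure_eq_cell]; linarith)
  have e1 : ((L + 2 * Real.log 2) / 4 - (Uplus + 2 * Real.log 2) / 4) / δ = (L - Uplus) / (4 * δ) := by
    field_simp; ring
  have e2 : ((Uminus + 2 * Real.log 2) / 4 - (L + 2 * Real.log 2) / 4) / δ = (Uminus - L) / (4 * δ) := by
    field_simp; ring
  rw [e1, e2] at hw
  exact hw

/-! ## §2 Box forms: three box words ⇒ an observable window at every box point -/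

/-- **THE ELECTRON COUNT OF EVERY EQUILIBRIUM ON A TYPED BOX** (`β, δ > 0`): a FLOOR word at reference level `εp` and CAP words at `εp + δ` and `εp − δ`
(all on the same Emery box `E`, same sign pattern) give, for every `p ∈ E` and every `2×2`-periodic equilibrium `ω` at `(β, emeryLine s (emeryLineCoords εp p))`:
`(L − U₊)/(βδ) ≤ ρ_Cu(ω) + ρ_{O_x}(ω) + ρ_{O_y}(ω) ≤ (U₋ − L)/(βδ)`. [cite: Griffiths1964, Eq. (39) and Fig. 3] [cite: Israel1979, Thm. I.2.4] -/
theorem holdsOn_emery_electronCount_window (E : EmeryBox) (s : Fin 4 → ℝ) {β : ℝ} (hβ : 0 < β) (εp : ℝ) {δ : ℝ} (hδ : 0 < δ)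
    {L Uplus Uminus : ℝ}
    (hL : HoldsOn (fun p : EmeryCoord → ℝ => L ≤ emeryCellPressure β (emeryLine s (emeryLineCoords εp p))) E)
    (hUp : HoldsOn (fun p : EmeryCoord → ℝ => emeryCellPressure β (emeryLine s (emeryLineCoords (εp + δ) p)) ≤ Uplus) E)
    (hUm : HoldsOn (fun p : EmeryCoord → ℝ => emeryCellPressure β (emeryLine s (emeryLineCoords (εp - δ) p)) ≤ Uminus) E) :
    HoldsOn (fun p : EmeryCoord → ℝ => ∀ ω : InfVolFermionState 2,
      ω.IsPerVarEquilibrium β liebPeriods (emeryInteraction (emeryLine s (emeryLineCoords εp p))) 1 →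
        ω.densityAt cuSite + ω.densityAt oxSite + ω.densityAt oySite ∈ Set.Icc ((L - Uplus) / (β * δ)) ((Uminus - L) / (β * δ))) E := by
  intro p hp ω hω
  have h1 := hUp p hp
  have h2 := hUm p hp
  simp only at h1 h2
  rw [emeryLine_emeryLineCoords_add] at h1
  rw [sub_eq_add_neg, emeryLine_emeryLineCoords_add] at h2
  exact emery_electronCount_mem_Icc_of_cellPressureBounds hβ hω hδ (hL p hp) h1 h2

/-- **THE ENERGY OF EVERY EQUILIBRIUM ON A TYPED BOX** (`δ > 0`): a floor word at `β` and cap words at `β + δ`, `β − δ` (same `εp`, same box) give, for every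
`p ∈ E` and every equilibrium `ω` at `(β, θ(p))`: `(L − U₊)/(4δ) ≤ ē(ω) ≤ (U₋ − L)/(4δ)`. [cite: Griffiths1964, Eq. (39) and Fig. 3] [cite: Israel1979, Thm. I.2.4] -/
theorem holdsOn_emery_cellEnergy_window (E : EmeryBox) (s : Fin 4 → ℝ) (β εp : ℝ) {δ : ℝ} (hδ : 0 < δ) {L Uplus Uminus : ℝ}
    (hL : HoldsOn (fun p : EmeryCoord → ℝ => L ≤ emeryCellPressure β (emeryLine s (emeryLineCoords εp p))) E)
    (hUp : HoldsOn (fun p : EmeryCoord → ℝ => emeryCellPressure (β + δ) (emeryLine s (emeryLineCoords εp p)) ≤ Uplus) E)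
    (hUm : HoldsOn (fun p : EmeryCoord → ℝ => emeryCellPressure (β - δ) (emeryLine s (emeryLineCoords εp p)) ≤ Uminus) E) :
    HoldsOn (fun p : EmeryCoord → ℝ => ∀ ω : InfVolFermionState 2,
      ω.IsPerVarEquilibrium β liebPeriods (emeryInteraction (emeryLine s (emeryLineCoords εp p))) 1 →
        InfVolFermionState.cellMeanEnergy liebPeriods (emeryInteraction (emeryLine s (emeryLineCoords εp p))) ω 1 ∈
          Set.Icc ((L - Uplus) / (4 * δ)) ((Uminus - L) / (4 * δ))) E :=
  fun p hp _ hω => emery_cellMeanEnergy_mem_Icc_of_cellPressureBounds hω hδ (hL p hp) (hUp p hp) (hUm p hp)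

/-- **Equilibria exist at every box point** (so the windows above are never vacuous). [cite: Israel1979, Thm. I.2.4] -/
theorem holdsOn_exists_emery_equilibrium (E : EmeryBox) (s : Fin 4 → ℝ) (β εp : ℝ) :
    HoldsOn (fun p : EmeryCoord → ℝ => ∃ ω : InfVolFermionState 2,
      ω.IsPerVarEquilibrium β liebPeriods (emeryInteraction (emeryLine s (emeryLineCoords εp p))) 1) E :=
  fun _ _ => exists_isPerVarEquilibrium_emery β _

/-! ## §3 La₂CuO₄ (#18): the windows on `emeryBoxLa214v123` -/

/-- **La₂CuO₄: the T > 0 electron count per CuO₂ of every equilibrium on the v1.23 companion from three box words** (floor at `εp`, caps at `εp ± δ`;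
cuprate sign pattern). S1's row for this box is `n_holes = 1`, i.e. `n = 5` per CuO₂ in the decorated convention. [cite: Griffiths1964, Eq. (39) and Fig. 3] -/
theorem emeryBoxLa214v123_electronCount_window {β : ℝ} (hβ : 0 < β) (εp : ℝ) {δ : ℝ} (hδ : 0 < δ) {L Uplus Uminus : ℝ}
    (hL : HoldsOn (fun p : EmeryCoord → ℝ => L ≤ emeryCellPressure β (emeryLine cuprateSigns (emeryLineCoords εp p))) emeryBoxLa214v123)
    (hUp : HoldsOn (fun p : EmeryCoord → ℝ => emeryCellPressure β (emeryLine cuprateSigns (emeryLineCoords (εp + δ) p)) ≤ Uplus) emeryBoxLa214v123)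
    (hUm : HoldsOn (fun p : EmeryCoord → ℝ => emeryCellPressure β (emeryLine cuprateSigns (emeryLineCoords (εp - δ) p)) ≤ Uminus) emeryBoxLa214v123) :
    HoldsOn (fun p : EmeryCoord → ℝ => ∀ ω : InfVolFermionState 2,
      ω.IsPerVarEquilibrium β liebPeriods (emeryInteraction (emeryLine cuprateSigns (emeryLineCoords εp p))) 1 →
        ω.densityAt cuSite + ω.densityAt oxSite + ω.densityAt oySite ∈ Set.Icc ((L - Uplus) / (β * δ)) ((Uminus - L) / (β * δ))) emeryBoxLa214v123 :=
  holdsOn_emery_electronCount_window emeryBoxLa214v123 cuprateSigns hβ εp hδ hL hUp hUm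

/-- **La₂CuO₄: the T > 0 energy per site of every equilibrium on the v1.23 companion from three box words** (floor at `β`, caps at `β ± δ`).
[cite: Griffiths1964, Eq. (39) and Fig. 3] -/
theorem emeryBoxLa214v123_cellEnergy_window (β εp : ℝ) {δ : ℝ} (hδ : 0 < δ) {L Uplus Uminus : ℝ}
    (hL : HoldsOn (fun p : EmeryCoord → ℝ => L ≤ emeryCellPressure β (emeryLine cuprateSigns (emeryLineCoords εp p))) emeryBoxLa214v123)
    (hUp : HoldsOn (fun p : EmeryCoord → ℝ => emeryCellPressure (β + δ) (emeryLine cuprateSigns (emeryLineCoords εp p)) ≤ Uplus) emeryBoxLa214v123)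
    (hUm : HoldsOn (fun p : EmeryCoord → ℝ => emeryCellPressure (β - δ) (emeryLine cuprateSigns (emeryLineCoords εp p)) ≤ Uminus) emeryBoxLa214v123) :
    HoldsOn (fun p : EmeryCoord → ℝ => ∀ ω : InfVolFermionState 2,
      ω.IsPerVarEquilibrium β liebPeriods (emeryInteraction (emeryLine cuprateSigns (emeryLineCoords εp p))) 1 →
        InfVolFermionState.cellMeanEnergy liebPeriods (emeryInteraction (emeryLine cuprateSigns (emeryLineCoords εp p))) ω 1 ∈
          Set.Icc ((L - Uplus) / (4 * δ)) ((Uminus - L) / (4 * δ))) emeryBoxLa214v123 :=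
  holdsOn_emery_cellEnergy_window emeryBoxLa214v123 cuprateSigns β εp hδ hL hUp hUm

end Summit.Ventures.CertifiedManyBodySolver.Downfold

end
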